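import Mathlib
import HarnessLib
import HarnessLib.Audit
import Summits.HodgeConjecture.HodgeConjecture.Theses.IncidenceNodePeeling
import Summits.HodgeConjecture.HodgeConjecture.Theses.QbarEnvelope
import Literature.AlgebraicGeometry.Motives.BaseChange

/-!
# Line `qbar_envelope` — alternative skeleton for the crux `HCMovablePairs` (stmt-HodgeConjecture-2348)

Route `IncidenceNodePeeling` (route-HodgeConjecture-IncidenceNodePeeling), crux `HCMovablePairs` (rank 5): a rational
`(p,p)`-class `ζ` on a smooth degree-`d` hypersurface `X ⊂ ℙ^{2p+1}_ℂ` whose pair `(X, ζ)` is MOVABLE is algebraic.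
Registered ALONGSIDE the live skeleton `Lines/birth.lean` (never over it) by the crux-strategist seat
`planner-cstrat-stmt-HodgeConjecture-2348-s2-0`, 2026-08-17. Lens: TRANSFER (to the sibling route `QbarEnvelope` =
Voisin's ℚ̄-funnel), applied at crux level.

THE LINE = CHANGE OF CURRENCY, transcendental → arithmetic. Movability is exactly the hypothesis under which the
field-of-definition theorems of Klingler–Otwinowska–Urbanik bite: a movable pair has a Hodge-locus component of
POSITIVE PERIOD DIMENSION (infinitesimal Torelli for hypersurfaces), and such components — when weakly non-factor —
are defined over `ℚ̄` (KOU 2023 Thm 1.12 (a), read: arXiv:2010.03359 p. 5); Voisin 2007 Prop. 1.7 / Charles–Schnell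
Thm 11.3.19 then make `ζ` the pull-back of a rational `(p,p)` class on a smooth projective variety definable over a
number field (global invariant cycle theorem over a `ℚ̄`-compactification of the family over the component, after the
finite base change killing the monodromy orbit of `ζ`). So:

* `stub_movableEnvelope : MovableEnvelope` — every movable hypersurface pair has a ℚ̄-ENVELOPE: `ζ = ι^* c'` for a
  ℂ-morphism `ι : X ⟶ W` into a smooth projective `W` definable over a number field and a rational `(p,p)` class `c'`
  on `W`. It is `QbarEnvelope.Envelope` (stmt-1069) RESTRICTED to movable hypersurface pairs
  (`movableEnvelope_of_envelope`, one line, sorry-free), and — unlike the unrestricted Envelope, whose dark case is the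
  isolated transcendental Hodge point — it is a THEOREM IN PRINT for weakly non-factor components (KOU 2023 Thm 1.12 +
  Voisin 2007 Prop. 1.7), i.e. known except on FACTOR components (KOU Def. 1.10: the algebraic monodromy of the
  component is a strict normal subgroup of that of a larger special subvariety), where KOU Cor. 1.14 reduces the
  question to special POINTS.
* `stub_hcOverNumberFields : QbarEnvelope.HCOverNumberFields` — the sibling route's crux stmt-1070 BY NAME (the Hodge
  conjecture for smooth projective varieties definable over a number field: Tate / absolute-Hodge / crystalline tools).
* `stub_pullbackAlgebraic : QbarEnvelope.PullbackAlgebraic` — the sibling route's support item stmt-1071 BY NAME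
  (pull-back of algebraic classes along a morphism of smooth projective varieties is algebraic: Fulton Ch. 6, §8.1,
  Cor. 19.2; theorem in print).
* `HCMovablePairs_of : MovableEnvelope → HCOverNumberFields → PullbackAlgebraic → HCMovablePairs` — the skeleton
  theorem, a REAL proof (no sorry): take the envelope `(W, ι, c')`, apply HC/ℚ̄ to `W`, pull back along `ι`.
  `HCMovablePairs_of_stubs : HCMovablePairs` instantiates it with the three stubs.

What it dodges: ALL THREE stubs of `birth` (no degeneration, no semiregularity / return across nodes, no variational
Hodge statement) and both open stubs of `local_anchor` (no anchor geography, no local VHC): propagation along the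
component is packaged in the global invariant cycle theorem over the ℚ̄-total space, and algebraicity is paid ONCE, on a
ℚ̄-variety, by the shared crux stmt-1070. Honest price: the line makes `HCMovablePairs` visibly a special case of the
QbarEnvelope funnel (`Envelope ∧ HCOverNumberFields`), with the envelope half nearly known — so its hard stub is
HC/ℚ̄ for the (2p + dim Z)-dimensional total spaces `W`, not for hypersurfaces. By the THICKENING LEMMA of this seat's
STRATEGY-CENSUS.md (movable pairs absorb rigid pairs of lower dimension), no line for this crux can avoid paying HC for
rigid hypersurface pairs somewhere; here they are paid inside stmt-1070 (a rigid pair over ℚ̄) and inside the factor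
case of stub 1 (a rigid pair at a transcendental parameter — the dark case of every arithmetic line).

Disproof used: none exists for this crux (no `Disproof.lean`, no `_false_without_`, no landed Negative lemma,
2026-08-17). The sibling analysis `Cruxes/Envelope/BC3-PROBES.md` / `Lines/birth.lean` (crux stmt-1069) is honoured:
stub 1 is the movable RESTRICTION of Envelope, not a re-filing of it, and the four inputs T/C/D/N of the Envelope line
close stub 1 as well (T restricted to points whose ℚ̄-Zariski closure lies in a positive-period-dimensional component
is exactly what KOU Thm 1.12 supplies in the weakly non-factor case). Negatives index (3 entries): no stub is an
instance. All three stubs are implied by HC (stub 1 via HC ⇒ Envelope: pull Chern-class polynomials back from products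
of Grassmannians); none implies the crux or the summit cheaply (BC3 probes, seat folder `bc/`).
-/

set_option linter.dupNamespace false
set_option linter.unusedVariables false

namespace Summit.HodgeConjecture.HodgeConjecture.Cruxes.HCMovablePairs.QbarEnvelopeLine

open scoped BigOperators

/-! ## §1 The stub STATEMENT (named Prop, fully qualified so a prover can restate it verbatim) -/

/-- **Statement of stub 1 — ℚ̄-envelopes of movable hypersurface pairs.** For every MOVABLE pair `(X, ζ)` (hypotheses
verbatim those of `HCMovablePairs`) there are a smooth projective complex variety `W` DEFINABLE OVER A NUMBER FIELD
(`W ≅ W₀ ⊗_{K,σ} ℂ`, `K` a number field — the spelling of `QbarEnvelope.Envelope` / `HCOverNumberFields`), a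
ℂ-morphism `ι : X ⟶ W` and a rational `(p,p)` class `c'` on `W` with `ι^* c' = ζ`. Why plausibly true: (i) it is
`QbarEnvelope.Envelope` restricted to these pairs (`movableEnvelope_of_envelope`); (ii) THEOREM IN PRINT off factor
components: movable ⟹ the Hodge-locus component `Z` of `ζ` in `U_d = |O(d)| ∖ Δ` (a special subvariety for the ℤVHS
`R^{2p}_prim`, `U_d` defined over `ℚ`) has positive period dimension (infinitesimal Torelli for hypersurfaces,
`(2p,d) ≠ (2,3)`); if `Z` is weakly non-factor it is defined over `ℚ̄` (Klingler–Otwinowska–Urbanik 2023 Thm 1.12 (a));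
then Voisin 2007 Prop. 1.7 = Charles–Schnell Thm 11.3.19: after the finite cover `Z' → Z` trivialising the (finite,
by Hodge–Riemann + lattice finiteness) monodromy orbit of `ζ`, a smooth ℚ̄-compactification `W` of the universal
family over `Z'` carries, by Deligne's global invariant cycle theorem and semisimplicity, a rational `(p,p)` class
`c'` with `c'|_{X} = ζ`; (iii) implied by HC (algebraic `ζ` is a Chern-class polynomial pulled back from a product of
Grassmannians, which are defined over `ℚ`). Why it might fail: FACTOR components (KOU Def. 1.10 — the algebraic
monodromy `H_Z` is a strict normal subgroup of `H_{Z⁺}` for a larger irreducible `Z⁺ ⊇ Z`; e.g. Sebastiani–Thom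
families `F(x) + G_t(y)` with a rigid special `F`) are not covered by KOU: there ℚ̄-definability of `Z` is the
definability of a special POINT of the factor (KOU Cor. 1.14), the dark case; a movable class on such a component with
`[F]` transcendental and no ℚ̄-envelope would refute this stub AND the Hodge conjecture. Size: L off factor components
(inputs: KOU Thm 1.12, CDK, Deligne partie fixe = item stmt-16363, Riemann existence / number-field descent as in
`Cruxes/Envelope/Lines/birth.lean` stubs C, D, N), open on factor components.
[cite: KlinglerOtwinowskaUrbanik2023, Thm 1.12 (a), Def. 1.10, Cor. 1.14 (arXiv:2010.03359 pp. 4–5)]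
[cite: Voisin2007HodgeLoci, Prop. 1.7] [cite: CharlesSchnell2014Notes, Thm 11.3.19] [cite: CattaniDeligneKaplan1995, Thm 1.1] -/
def MovableEnvelope : Prop :=
  ∀ (p d : ℕ) (X : Literature.AlgebraicGeometry.Motives.SchemeOver ℂ)
    (ζ : Literature.AlgebraicGeometry.HodgeTheory.complexBetti X (2 * p)),
    Literature.AlgebraicGeometry.Motives.IsSmoothHypersurface (2 * p) d X →
    Literature.AlgebraicGeometry.HodgeTheory.IsRationalClass ζ →
    Literature.AlgebraicGeometry.HodgeTheory.IsOfHodgeType (2 * p) X (2 * p) p p ζ →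
    (∃ (S 𝒳 : Literature.AlgebraicGeometry.Motives.SchemeOver ℂ) (f : 𝒳 ⟶ S) (s : Literature.AlgebraicGeometry.Motives.ComplexPoints S) (e : Literature.AlgebraicGeometry.Motives.fiberOver f s ≅ X) (Ξ : Literature.AlgebraicGeometry.HodgeTheory.complexBetti 𝒳 (2 * p)), Literature.AlgebraicGeometry.Motives.IsSmoothProjectiveFamily f (2 * p) ∧ AlgebraicGeometry.LocallyOfFiniteType S.hom ∧ IrreducibleSpace S.left ∧ (∀ t : Literature.AlgebraicGeometry.Motives.ComplexPoints S, Literature.AlgebraicGeometry.Motives.IsSmoothHypersurface (2 * p) d (Literature.AlgebraicGeometry.Motives.fiberOver f t)) ∧ (∃ t : Literature.AlgebraicGeometry.Motives.ComplexPoints S, IsEmpty (Literature.AlgebraicGeometry.Motives.fiberOver f t ≅ Literature.AlgebraicGeometry.Motives.fiberOver f s)) ∧ Literature.AlgebraicGeometry.HodgeTheory.IsRationalClass Ξ ∧ (∀ t : Literature.AlgebraicGeometry.Motives.ComplexPoints S, Literature.AlgebraicGeometry.HodgeTheory.IsOfHodgeType (2 * p) (Literature.AlgebraicGeometry.Motives.fiberOver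 f t) (2 * p) p p ((Literature.AlgebraicGeometry.HodgeTheory.complexBetti.map (Literature.AlgebraicGeometry.Motives.fiberι f t) (2 * p)).hom Ξ)) ∧ (Literature.AlgebraicGeometry.HodgeTheory.complexBetti.map (Literature.AlgebraicGeometry.Motives.fiberι f s) (2 * p)).hom Ξ = (Literature.AlgebraicGeometry.HodgeTheory.complexBetti.map e.hom (2 * p)).hom ζ) →
    ∃ (m : ℕ) (W : Literature.AlgebraicGeometry.Motives.SchemeOver ℂ) (ι : X ⟶ W)
      (c' : Literature.AlgebraicGeometry.HodgeTheory.complexBetti W (2 * p)),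
      Literature.AlgebraicGeometry.Motives.IsSmoothProjective m W ∧
      (∃ (K : Type) (_ : Field K) (_ : NumberField K) (σ : K →+* ℂ)
          (W₀ : Literature.AlgebraicGeometry.Motives.SchemeOver K),
        Nonempty (W ≅ (Literature.AlgebraicGeometry.Motives.baseChangeHom σ).obj W₀)) ∧
      Literature.AlgebraicGeometry.HodgeTheory.IsRationalClass c' ∧
      Literature.AlgebraicGeometry.HodgeTheory.IsOfHodgeType m W (2 * p) p p c' ∧
      Literature.AlgebraicGeometry.HodgeTheory.complexBetti.map ι (2 * p) c' = ζ

/-! ## §2 The three registered stubs (`sorry` lives ONLY here) -/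

/-- **Stub 1** — `MovableEnvelope` (docstring above). The line's own NEW stub; nearly known (KOU + Voisin) off factor
components. [cite: KlinglerOtwinowskaUrbanik2023, Thm 1.12 (a)] [cite: Voisin2007HodgeLoci, Prop. 1.7] -/
theorem stub_movableEnvelope : MovableEnvelope := by
  sorry

/-- **Stub 2 — the Hodge conjecture over number fields** = the sibling route's crux stmt-HodgeConjecture-1070,
`QbarEnvelope.HCOverNumberFields`, BY NAME. The HARDEST stub (HC for smooth projective ℚ̄-varieties; decisive open
sub-family: Weil classes on CM abelian varieties of Weil type; here consumed only for the ℚ̄-total spaces `W`).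
[cite: Voisin2007HodgeLoci, Prop. 1.2 and Prop. 1.7] [cite: Deligne1982HodgeCycles, Thm 2.11] -/
theorem stub_hcOverNumberFields :
    Summit.HodgeConjecture.HodgeConjecture.Theses.QbarEnvelope.HCOverNumberFields := by
  sorry

/-- **Stub 3 — pull-back preserves algebraic classes** = the sibling route's support item stmt-HodgeConjecture-1071,
`QbarEnvelope.PullbackAlgebraic`, BY NAME (Fulton, Intersection Theory, Ch. 6, §8.1, Cor. 19.2: refined Gysin
pull-back along a morphism to a smooth variety and `cl(ι^! z) = ι^* cl(z)`; theorem in print, size L).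
[cite: Fulton1998, Cor. 19.2] -/
theorem stub_pullbackAlgebraic :
    Summit.HodgeConjecture.HodgeConjecture.Theses.QbarEnvelope.PullbackAlgebraic := by
  sorry

/-! ## §3 The composition: the three stubs prove the crux BY NAME (sorry-free) -/

/-- **THE SKELETON THEOREM** (`stub₁-sig → stub₂-sig → stub₃-sig → crux`, conclusion = the route decl
`…Theses.IncidenceNodePeeling.HCMovablePairs` BY NAME). Real proof: the envelope `(m, W, ι, c')` of stub 1; `W` is
smooth projective and definable over a number field, so stub 2 gives `c' ∈ algebraicClasses W p`; stub 3 pulls back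
along `ι` (`X` is smooth projective: first conjunct of `IsSmoothHypersurface`). [folklore] -/
theorem HCMovablePairs_of :
    MovableEnvelope →
    Summit.HodgeConjecture.HodgeConjecture.Theses.QbarEnvelope.HCOverNumberFields →
    Summit.HodgeConjecture.HodgeConjecture.Theses.QbarEnvelope.PullbackAlgebraic →
    Summit.HodgeConjecture.HodgeConjecture.Theses.IncidenceNodePeeling.HCMovablePairs := by
  intro hE hC hP p d X ζ hX hq hpp hmov
  unfold MovableEnvelope at hE
  obtain ⟨m, W, ι, c', hW, hWK, hc', hpp', hι⟩ := hE p d X ζ hX hq hpp hmov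
  rw [← hι]
  exact hP hX.1 hW ι p c' ((hC hW hWK).2 p c' hc' hpp')

/-- **Registered target of the skeleton** — the crux BY NAME with NO hypotheses (`sorryAx` is reached exactly through
the three `stub_*`; closes nothing until they land). -/
theorem HCMovablePairs_of_stubs :
    Summit.HodgeConjecture.HodgeConjecture.Theses.IncidenceNodePeeling.HCMovablePairs :=
  HCMovablePairs_of stub_movableEnvelope stub_hcOverNumberFields stub_pullbackAlgebraic

/-! ## §4 Recorded relations (sorry-free) -/

/-- Stub 1 is `QbarEnvelope.Envelope` (stmt-HodgeConjecture-1069) RESTRICTED to movable hypersurface pairs: a proof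
of that shared crux closes stub 1 at once (the movable datum unused). [folklore] -/
theorem movableEnvelope_of_envelope
    (hEnv : Summit.HodgeConjecture.HodgeConjecture.Theses.QbarEnvelope.Envelope) : MovableEnvelope :=
  fun p _d _X ζ hX hq hpp _ => hEnv hX.1 p ζ hq hpp

/-- `S → crux` (recorded converse probe, as in `birth`): the crux is a consequence of the summit. [folklore] -/
example (h : _root_.HodgeConjecture) :
    Summit.HodgeConjecture.HodgeConjecture.Theses.IncidenceNodePeeling.HCMovablePairs :=
  fun p _d _X ζ hX hq hpp _ => (h hX.1).2 p ζ hq hpp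

end Summit.HodgeConjecture.HodgeConjecture.Cruxes.HCMovablePairs.QbarEnvelopeLine
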